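import Summits.QuantumFields.YangMills.Theorems.BalabanUVNodesN21ThresholdMixtureCommonBox
import Summits.QuantumFields.YangMills.Theorems.BalabanUVNodesN21AtSpineCarriersMixture

/-!
# YM-DAG node N21 (= NE7c) — THE THRESHOLD MIXTURE, PART 4b: the (η)-face knit and the K5 reading `S_N21 SRec` with the N20 in-edge in
# print's currency — a SHARP class-relative sibling bound at every threshold assignment of the COMMON box (file 10a)

Track A of `YM-PLAN.md` (cell `pub-ymgap`, HUMAN RULING D-0062), node **N21**; R141 (C) fan-out seat `pub-ymgap-dag-n21-e` (s3 = ALTERNATIVE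
CURRENCY), generation 3, file 10b.  Companions: file 6 `…N21AtSpineCarriersMixture` (p468321: `n21_knit_sharpMixture`, `s_N21_of_sharpMixtureReading`
— the (η) face with the N20 in-edge `SiblingSuppression … (sibW (linProfile ∘ κ) …) Ssup` on PROFILED siblings), file 10a `…N21ThresholdMixtureCommonBox`
(`siblingSuppression_of_sharpCommonBox`).  Kernel bookkeeping: 0 `def`, 0 `sorry`, standard axioms.  COUNT-NEUTRAL; `--supports` the K3′ item
`SpineGivenEndpointR12` as a helper.

WHAT THIS FILE DOES.  §1 `n21_knit_sharpMixture_commonBox`: file 6's explicit-carrier knit with its two `SiblingSuppression` binders REPLACED by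
OCCURRENCE DATA (per step `K`: `nC K` occurrences of background-mediated characteristic functions, ages `aC K c`, nominal thresholds `θC K c > 0`;
each term's INJECTIVE coordinate map `e K τ` consistent with its slots and thresholds — ONE multiplier per occurrence, lens (O-mix-3′)) and, for
each run, the SHARP class-relative sibling bound `Σ_τ Sbs σ K t τ (S ∘ e K τ) ≤ Ssup(a)·Σ_τ Xs K t τ (S ∘ e K τ)` at EVERY threshold assignment `S`
of the common box (N20's statement in print's currency: band at the nominal threshold × the other characteristic functions SHARP).  §2
**`s_N21_of_sharpCommonBoxReading`**: `S_N21 SRec` for every carrier predicate handing that package.  The vacuity guard (a two-term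
DECOMPOSITION OF UNITY sharing one occurrence, on which `S_N21` fires) is the companion file 10c `…N21AtSpineCarriersMixtureCommonBoxSanity`.

HONEST FRAMING.  NE7c is NOT PRINTED and NOT PROVED.  Displayed binders (never discharged here): (O-mix-1) NODE O's threshold-free sharp
representations `hXs`∕`hSbs` and the pinning of the carriers as normalised threshold averages; (O-mix-2) `SupClose` (N16) and the sharp uniform
sibling bounds `hsharpA`∕`hsharpB` (N20, NE7b species: [Balaban1989LargeFieldII] (1.79) p. 383 at [Balaban1989LargeFieldI] p. 193's lowered
threshold), the width `ρ`, the record weight `Wsh`.  The mixture is a convex combination of print's SHARP procedure over admissible threshold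
vectors — NOT print verbatim; (M1) for the deterministic sharp procedure NOT claimed; N21 NOT discharged; count-neutral; one finite four-torus
programme at fixed `ε`; NOT continuum ∕ ℝ⁴ ∕ OS ∕ mass gap ∕ Clay.

CITATION HEADER (lean-in-tree rule 2026-08-18).  BY NAME: file 6 `n21_knit_sharpMixture`; file 10a `siblingSuppression_of_sharpCommonBox`;
`T4LipschitzCutoff.SiblingSuppression` ∕ `linProfile` ∕ `lipWeight`; `T4LipschitzLedger.SupClose` ∕ `sibW` ∕ `shellW` ∕ `Pol`; `T4IndicatorShell.ShellWeightBound`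
∕ `smallInd`; `…ClustersCore` (`SpineCarriers`, `SpineRecordPred`, `S_N21`).  Context only (SHAPE): [Balaban1988Convergent] (2.17)∕(2.18) p. 257.

WHAT IS PROVED ([folklore]).  §1 `n21_knit_sharpMixture_commonBox` · §2 **`s_N21_of_sharpCommonBoxReading`**.
-/

set_option autoImplicit false

noncomputable section

open MeasureTheory Set
open scoped BigOperators ENNReal

namespace Summit.QuantumFields.YangMills.Theorems.N21AtSpineCarriersMixtureCommonBox

open YMDAG.UVSplit (SpineCarriers SpineRecordPred S_N21)
open Literature.MathematicalPhysics.QuantumFieldTheory.Balaban1983to89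
open Literature.MathematicalPhysics.QuantumFieldTheory.Balaban1983to89.T4LipschitzCutoff
open Literature.MathematicalPhysics.QuantumFieldTheory.Balaban1983to89.T4IndicatorShell
open Literature.MathematicalPhysics.QuantumFieldTheory.Balaban1983to89.T4LipschitzLedger
open N21ThresholdMixtureCommonBox (siblingSuppression_of_sharpCommonBox)
open N21AtSpineCarriersMixture (n21_knit_sharpMixture)

/-! ## §1 Explicit carriers: the (η) knit with the N20 in-edge as a SHARP class-relative bound on the common box -/

section Explicit

variable {ι : Type*} {Ω : ℕ → ι → Type*} [∀ K τ, MeasurableSpace (Ω K τ)]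
  {l₀ : ℝ} {T : ℕ → Finset ι} {A B shA shB : ℕ → ℝ → ι → ℝ} {κ : ℕ → ℝ} {N : ℕ} {n : ℕ → ℕ}
  {μ : (K : ℕ) → (τ : ι) → Measure (Ω K τ)} [∀ K τ, SFinite (μ K τ)] {m : ℕ → ι → ℕ} {slot : ℕ → ι → ℕ → Σ _ : ℕ, ℕ}
  {pol : ℕ → ι → ℕ → Pol} {θ : ℕ → ι → ℕ → ℝ} {uA uB : (K : ℕ) → (τ : ι) → ℕ → Ω K τ → ℝ}
  {RA RB : (K : ℕ) → ℝ → (τ : ι) → Ω K τ → ℝ} {ρ S : ℕ → ℝ}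
  {nC : ℕ → ℕ} {aC : ℕ → ℕ → ℕ} {θC : ℕ → ℕ → ℝ} {e : (K : ℕ) → (τ : ι) → Fin (m K τ) → Fin (nC K)}

/-- **N21 KNIT ON THE MIXTURE ROAD, EXPLICIT CARRIERS, N20 IN PRINT's CURRENCY.**  File 6's `n21_knit_sharpMixture` with its two
`SiblingSuppression` binders REPLACED by: occurrence data per step (`nC`, ages `aC`, nominal thresholds `θC > 0`), each term's INJECTIVE
coordinate map `e K τ` consistent with slots and thresholds, the two runs' sharp sibling weights `Sbs^A`, `Sbs^B` in file 9's letters, and the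
SHARP class-relative sibling bounds `hsharpA`, `hsharpB` at EVERY threshold assignment of the common box `∏_c [(1 − κ_{aC K c})·θC K c, θC K c]`.
THEN `ShellWeightBound l₀ T A B shA shB Wsh` for every summable `Wsh` above the band weight — file 10a's `siblingSuppression_of_sharpCommonBox`
(×2) fed to file 6 BY NAME.  NO anti-concentration, NO profiled tower, NO profiled sibling statement.  CONDITIONAL on every displayed binder;
NE7c NOT proved. [folklore] -/
theorem n21_knit_sharpMixture_commonBox (XsA XsB : (K : ℕ) → ℝ → (τ : ι) → (Fin (m K τ) → ℝ) → ℝ)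
    (SbsA SbsB : (Σ _ : ℕ, ℕ) → (K : ℕ) → ℝ → (τ : ι) → (Fin (m K τ) → ℝ) → ℝ) (hκ : ∀ a, 0 < κ a ∧ κ a < 1)
    (thr_pos : ∀ K, ∀ τ ∈ T K, ∀ i < m K τ, 0 < θ K τ i)
    (slot_mem : ∀ K, ∀ τ ∈ T K, ∀ i < m K τ, slot K τ i ∈ (Finset.range (N + 1)).sigma fun a => Finset.range (n a))
    (slot_band : ∀ K, ∀ τ ∈ T K, ∀ i < m K τ, (slot K τ i).1 ≤ K)
    (meas : ∀ K, ∀ τ ∈ T K, ∀ i < m K τ, Measurable (uA K τ i) ∧ Measurable (uB K τ i))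
    (remA_nonneg : ∀ K t, |t| ≤ l₀ → ∀ τ ∈ T K, 0 ≤ᵐ[μ K τ] RA K t τ)
    (remA_int : ∀ K t, |t| ≤ l₀ → ∀ τ ∈ T K, Integrable (RA K t τ) (μ K τ))
    (remB_nonneg : ∀ K t, |t| ≤ l₀ → ∀ τ ∈ T K, 0 ≤ᵐ[μ K τ] RB K t τ)
    (remB_int : ∀ K t, |t| ≤ l₀ → ∀ τ ∈ T K, Integrable (RB K t τ) (μ K τ))
    (hXsA : ∀ K t, |t| ≤ l₀ → ∀ τ ∈ T K, ∀ s : Fin (m K τ) → ℝ,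
      XsA K t τ s = ∫ v, (∏ i : Fin (m K τ), (pol K τ i).fac (smallInd (uA K τ i v) (s i))) * RA K t τ v ∂(μ K τ))
    (hXsB : ∀ K t, |t| ≤ l₀ → ∀ τ ∈ T K, ∀ s : Fin (m K τ) → ℝ,
      XsB K t τ s = ∫ v, (∏ i : Fin (m K τ), (pol K τ i).fac (smallInd (uB K τ i v) (s i))) * RB K t τ v ∂(μ K τ))
    (hA : ∀ K t, |t| ≤ l₀ → ∀ τ ∈ T K, A K t τ =
      (∏ i : Fin (m K τ), (κ (slot K τ i).1 * θ K τ i))⁻¹ *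
        ∫ s, XsA K t τ s ∂(Measure.pi fun i : Fin (m K τ) =>
          volume.restrict (Icc ((1 - κ (slot K τ i).1) * θ K τ i) (θ K τ i))))
    (hB : ∀ K t, |t| ≤ l₀ → ∀ τ ∈ T K, B K t τ =
      (∏ i : Fin (m K τ), (κ (slot K τ i).1 * θ K τ i))⁻¹ *
        ∫ s, XsB K t τ s ∂(Measure.pi fun i : Fin (m K τ) =>
          volume.restrict (Icc ((1 - κ (slot K τ i).1) * θ K τ i) (θ K τ i))))
    (hSbsA : ∀ σ K t, |t| ≤ l₀ → ∀ τ ∈ T K, ∀ s : Fin (m K τ) → ℝ,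
      SbsA σ K t τ s = ∑ i ∈ (Finset.range (m K τ)).filter (fun i => slot K τ i = σ),
          ∫ v, (pol K τ i).shell (uA K τ i v) (θ K τ i) (κ (slot K τ i).1) (ρ (K - (slot K τ i).1) * θ K τ i) *
            (∏ j : Fin (m K τ), (if (j : ℕ) = i then (1 : ℝ) else (pol K τ j).fac (smallInd (uA K τ j v) (s j)))) *
              RA K t τ v ∂(μ K τ))
    (hSbsB : ∀ σ K t, |t| ≤ l₀ → ∀ τ ∈ T K, ∀ s : Fin (m K τ) → ℝ,
      SbsB σ K t τ s = ∑ i ∈ (Finset.range (m K τ)).filter (fun i => slot K τ i = σ),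
          ∫ v, (pol K τ i).shell (uB K τ i v) (θ K τ i) (κ (slot K τ i).1) (ρ (K - (slot K τ i).1) * θ K τ i) *
            (∏ j : Fin (m K τ), (if (j : ℕ) = i then (1 : ℝ) else (pol K τ j).fac (smallInd (uB K τ j v) (s j)))) *
              RB K t τ v ∂(μ K τ))
    (hF : SupClose T μ m slot θ uA uB ρ)
    -- occurrence data: one multiplier per OCCURRENCE, each term reads its own occurrences injectively
    (hθC : ∀ K c, 0 < θC K c) (he : ∀ K, ∀ τ ∈ T K, Function.Injective (e K τ))
    (he_age : ∀ K, ∀ τ ∈ T K, ∀ j : Fin (m K τ), (slot K τ j).1 = aC K (e K τ j))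
    (he_thr : ∀ K, ∀ τ ∈ T K, ∀ j : Fin (m K τ), θ K τ j = θC K (e K τ j))
    -- N20 in print's currency: the SHARP class-relative sibling bound at EVERY threshold assignment of the common box, both runs
    (hsharpA : ∀ σ ∈ (Finset.range (N + 1)).sigma (fun a => Finset.range (n a)), ∀ K t, |t| ≤ l₀ →
      ∀ Sv : Fin (nC K) → ℝ, (∀ c : Fin (nC K), Sv c ∈ Icc ((1 - κ (aC K c)) * θC K c) (θC K c)) →
        ∑ τ ∈ T K, SbsA σ K t τ (fun j => Sv (e K τ j)) ≤ S σ.1 * ∑ τ ∈ T K, XsA K t τ (fun j => Sv (e K τ j)))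
    (hsharpB : ∀ σ ∈ (Finset.range (N + 1)).sigma (fun a => Finset.range (n a)), ∀ K t, |t| ≤ l₀ →
      ∀ Sv : Fin (nC K) → ℝ, (∀ c : Fin (nC K), Sv c ∈ Icc ((1 - κ (aC K c)) * θC K c) (θC K c)) →
        ∑ τ ∈ T K, SbsB σ K t τ (fun j => Sv (e K τ j)) ≤ S σ.1 * ∑ τ ∈ T K, XsB K t τ (fun j => Sv (e K τ j)))
    (hS : ∀ a ≤ N, 0 ≤ S a) (hρ0 : ∀ j, 0 ≤ ρ j) (hρ : Summable ρ)
    (hshA : shA = shellW (fun a => linProfile (κ a)) μ m slot pol θ uA uB RA)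
    (hshB : shB = shellW (fun a => linProfile (κ a)) μ m slot pol θ uB uA RB)
    {Wsh : ℕ → ℝ} (hWsh : ∀ K, ∑ a ∈ Finset.range (N + 1), (n a : ℝ) * lipWeight (fun a => (κ a)⁻¹) S ρ a K ≤ Wsh K)
    (hsum : Summable Wsh) : ShellWeightBound l₀ T A B shA shB Wsh :=
  n21_knit_sharpMixture XsA XsB hκ thr_pos slot_mem slot_band meas remA_nonneg remA_int remB_nonneg remB_int hXsA hXsB hA hB hF
    (siblingSuppression_of_sharpCommonBox XsA SbsA (fun a => (hκ a).1) thr_pos (fun K τ hτ i hi => (meas K τ hτ i hi).1) remA_int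
      hXsA hA hSbsA hθC he he_age he_thr hsharpA)
    (siblingSuppression_of_sharpCommonBox XsB SbsB (fun a => (hκ a).1) thr_pos (fun K τ hτ i hi => (meas K τ hτ i hi).2) remB_int
      hXsB hB hSbsB hθC he he_age he_thr hsharpB)
    hS hρ0 hρ hshA hshB hWsh hsum

end Explicit

/-! ## §2 At the spine carriers: `S_N21 SRec` for every common-box sharp-mixture reading -/

section AtCarriers

variable {N : ℕ} [NeZero N]

/-- **`S_N21` FOR EVERY COMMON-BOX SHARP-MIXTURE READING.**  If the carrier predicate `SRec` hands, with every bundle `S` it pins, the data of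
file 6's `s_N21_of_sharpMixtureReading` (per-term measurable spaces with s-finite measures, admissible widths, window, factor data, both runs'
measurable tested variables, nonnegative integrable threshold-free remainders, the two runs' SHARP weights with `S.A`, `S.B` PINNED as their
normalised threshold averages, `SupClose` with a summable width, the shell parts pinned, `S.Wsh` summable above the band weight) EXCEPT that
the two profiled `SiblingSuppression` conjuncts are REPLACED by occurrence data (`nC`, `aC`, `θC > 0`, injective consistent coordinate maps
`e`), the sharp sibling weights `Sbs^A`, `Sbs^B` (file 9's letters) and the SHARP class-relative sibling bounds at every threshold assignment of
the common box in both runs — then `S_N21 SRec` (§1).  NO anti-concentration, NO profiled tower, N20 read in print's currency. [folklore] -/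
theorem s_N21_of_sharpCommonBoxReading (SRec : SpineRecordPred N)
    (hread : ∀ (F : T4Continuum.T4Family) (D : YMDAG.UVSplit.Datum F N) (g₀ : ℕ → ℝ)
      (os : List (T4Continuum.ULoop F)) (S : SpineCarriers), SRec F D g₀ os S →
      ∃ (Ω : ℕ → S.ι → Type) (_mΩ : ∀ K τ, MeasurableSpace (Ω K τ)) (μ : (K : ℕ) → (τ : S.ι) → Measure (Ω K τ))
        (_sf : ∀ K τ, SFinite (μ K τ)) (κ : ℕ → ℝ) (Nw : ℕ) (n : ℕ → ℕ) (m : ℕ → S.ι → ℕ) (slot : ℕ → S.ι → ℕ → Σ _ : ℕ, ℕ)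
        (pol : ℕ → S.ι → ℕ → Pol) (θ : ℕ → S.ι → ℕ → ℝ) (uA uB : (K : ℕ) → (τ : S.ι) → ℕ → Ω K τ → ℝ)
        (RA RB : (K : ℕ) → ℝ → (τ : S.ι) → Ω K τ → ℝ) (XsA XsB : (K : ℕ) → ℝ → (τ : S.ι) → (Fin (m K τ) → ℝ) → ℝ)
        (ρ Ssup : ℕ → ℝ) (nC : ℕ → ℕ) (aC : ℕ → ℕ → ℕ) (θC : ℕ → ℕ → ℝ) (e : (K : ℕ) → (τ : S.ι) → Fin (m K τ) → Fin (nC K))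
        (SbsA SbsB : (Σ _ : ℕ, ℕ) → (K : ℕ) → ℝ → (τ : S.ι) → (Fin (m K τ) → ℝ) → ℝ),
        (∀ a, 0 < κ a ∧ κ a < 1) ∧
        (∀ K, ∀ τ ∈ S.T K, ∀ i < m K τ, 0 < θ K τ i) ∧
        (∀ K, ∀ τ ∈ S.T K, ∀ i < m K τ, slot K τ i ∈ (Finset.range (Nw + 1)).sigma fun a => Finset.range (n a)) ∧
        (∀ K, ∀ τ ∈ S.T K, ∀ i < m K τ, (slot K τ i).1 ≤ K) ∧
        (∀ K, ∀ τ ∈ S.T K, ∀ i < m K τ, Measurable (uA K τ i) ∧ Measurable (uB K τ i)) ∧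
        (∀ K t, |t| ≤ S.l₀ → ∀ τ ∈ S.T K, 0 ≤ᵐ[μ K τ] RA K t τ) ∧
        (∀ K t, |t| ≤ S.l₀ → ∀ τ ∈ S.T K, Integrable (RA K t τ) (μ K τ)) ∧
        (∀ K t, |t| ≤ S.l₀ → ∀ τ ∈ S.T K, 0 ≤ᵐ[μ K τ] RB K t τ) ∧
        (∀ K t, |t| ≤ S.l₀ → ∀ τ ∈ S.T K, Integrable (RB K t τ) (μ K τ)) ∧
        -- (O-mix-1) the two runs' threshold-free SHARP representations and the carriers as normalised threshold averages
        (∀ K t, |t| ≤ S.l₀ → ∀ τ ∈ S.T K, ∀ s : Fin (m K τ) → ℝ,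
          XsA K t τ s = ∫ v, (∏ i : Fin (m K τ), (pol K τ i).fac (smallInd (uA K τ i v) (s i))) * RA K t τ v ∂(μ K τ)) ∧
        (∀ K t, |t| ≤ S.l₀ → ∀ τ ∈ S.T K, ∀ s : Fin (m K τ) → ℝ,
          XsB K t τ s = ∫ v, (∏ i : Fin (m K τ), (pol K τ i).fac (smallInd (uB K τ i v) (s i))) * RB K t τ v ∂(μ K τ)) ∧
        (∀ K t, |t| ≤ S.l₀ → ∀ τ ∈ S.T K, S.A K t τ =
          (∏ i : Fin (m K τ), (κ (slot K τ i).1 * θ K τ i))⁻¹ *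
            ∫ s, XsA K t τ s ∂(Measure.pi fun i : Fin (m K τ) =>
              volume.restrict (Icc ((1 - κ (slot K τ i).1) * θ K τ i) (θ K τ i)))) ∧
        (∀ K t, |t| ≤ S.l₀ → ∀ τ ∈ S.T K, S.B K t τ =
          (∏ i : Fin (m K τ), (κ (slot K τ i).1 * θ K τ i))⁻¹ *
            ∫ s, XsB K t τ s ∂(Measure.pi fun i : Fin (m K τ) =>
              volume.restrict (Icc ((1 - κ (slot K τ i).1) * θ K τ i) (θ K τ i)))) ∧
        -- the two runs' SHARP SIBLING weights (file 9's letters)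
        (∀ σ K t, |t| ≤ S.l₀ → ∀ τ ∈ S.T K, ∀ s : Fin (m K τ) → ℝ,
          SbsA σ K t τ s = ∑ i ∈ (Finset.range (m K τ)).filter (fun i => slot K τ i = σ),
            ∫ v, (pol K τ i).shell (uA K τ i v) (θ K τ i) (κ (slot K τ i).1) (ρ (K - (slot K τ i).1) * θ K τ i) *
              (∏ j : Fin (m K τ), (if (j : ℕ) = i then (1 : ℝ) else (pol K τ j).fac (smallInd (uA K τ j v) (s j)))) *
                RA K t τ v ∂(μ K τ)) ∧
        (∀ σ K t, |t| ≤ S.l₀ → ∀ τ ∈ S.T K, ∀ s : Fin (m K τ) → ℝ,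
          SbsB σ K t τ s = ∑ i ∈ (Finset.range (m K τ)).filter (fun i => slot K τ i = σ),
            ∫ v, (pol K τ i).shell (uB K τ i v) (θ K τ i) (κ (slot K τ i).1) (ρ (K - (slot K τ i).1) * θ K τ i) *
              (∏ j : Fin (m K τ), (if (j : ℕ) = i then (1 : ℝ) else (pol K τ j).fac (smallInd (uB K τ j v) (s j)))) *
                RB K t τ v ∂(μ K τ)) ∧
        -- (O-mix-2) N16's `SupClose`; (O-mix-3′) the occurrence structure; N20 in print's currency on the common box, both runs
        SupClose S.T μ m slot θ uA uB ρ ∧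
        (∀ K c, 0 < θC K c) ∧ (∀ K, ∀ τ ∈ S.T K, Function.Injective (e K τ)) ∧
        (∀ K, ∀ τ ∈ S.T K, ∀ j : Fin (m K τ), (slot K τ j).1 = aC K (e K τ j)) ∧
        (∀ K, ∀ τ ∈ S.T K, ∀ j : Fin (m K τ), θ K τ j = θC K (e K τ j)) ∧
        (∀ σ ∈ (Finset.range (Nw + 1)).sigma (fun a => Finset.range (n a)), ∀ K t, |t| ≤ S.l₀ →
          ∀ Sv : Fin (nC K) → ℝ, (∀ c : Fin (nC K), Sv c ∈ Icc ((1 - κ (aC K c)) * θC K c) (θC K c)) →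
            ∑ τ ∈ S.T K, SbsA σ K t τ (fun j => Sv (e K τ j)) ≤ Ssup σ.1 * ∑ τ ∈ S.T K, XsA K t τ (fun j => Sv (e K τ j))) ∧
        (∀ σ ∈ (Finset.range (Nw + 1)).sigma (fun a => Finset.range (n a)), ∀ K t, |t| ≤ S.l₀ →
          ∀ Sv : Fin (nC K) → ℝ, (∀ c : Fin (nC K), Sv c ∈ Icc ((1 - κ (aC K c)) * θC K c) (θC K c)) →
            ∑ τ ∈ S.T K, SbsB σ K t τ (fun j => Sv (e K τ j)) ≤ Ssup σ.1 * ∑ τ ∈ S.T K, XsB K t τ (fun j => Sv (e K τ j))) ∧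
        (∀ a ≤ Nw, 0 ≤ Ssup a) ∧ (∀ j, 0 ≤ ρ j) ∧ Summable ρ ∧
        S.shA = shellW (fun a => linProfile (κ a)) μ m slot pol θ uA uB RA ∧
        S.shB = shellW (fun a => linProfile (κ a)) μ m slot pol θ uB uA RB ∧
        (∀ K, ∑ a ∈ Finset.range (Nw + 1), (n a : ℝ) * lipWeight (fun a => (κ a)⁻¹) Ssup ρ a K ≤ S.Wsh K) ∧ Summable S.Wsh) :
    S_N21 SRec := by
  intro F D g₀ os S hS
  obtain ⟨Ω, mΩ, μ, sf, κ, Nw, n, m, slot, pol, θ, uA, uB, RA, RB, XsA, XsB, ρ, Ssup, nC, aC, θC, e, SbsA, SbsB, hκ, thr_pos, slot_mem,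
    slot_band, meas, remA_nonneg, remA_int, remB_nonneg, remB_int, hXsA, hXsB, hA, hB, hSbsA, hSbsB, hF, hθC, he, he_age, he_thr,
    hsharpA, hsharpB, hS0, hρ0, hρ, hshA, hshB, hWsh, hsum⟩ := hread F D g₀ os S hS
  exact n21_knit_sharpMixture_commonBox XsA XsB SbsA SbsB hκ thr_pos slot_mem slot_band meas remA_nonneg remA_int remB_nonneg remB_int
    hXsA hXsB hA hB hSbsA hSbsB hF hθC he he_age he_thr hsharpA hsharpB hS0 hρ0 hρ hshA hshB hWsh hsum

end AtCarriers

end Summit.QuantumFields.YangMills.Theorems.N21AtSpineCarriersMixtureCommonBox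

end
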